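import Literature.MathematicalPhysics.QuantumFieldTheory.Balaban1983to89.B12Term286DifferentBlocks

/-!
# `Balaban1983to89.B12Term286SameBlock` — T. Bałaban, *Renormalization group approach to lattice gauge field
theories. I. Generation of effective actions in a small field approximation and a coupling constant renormalization in
four dimensions*, Commun. Math. Phys. **109** (1987) 249–301 [Balaban1987RG1], p. 286: the SAME-BLOCK terms of the
second sum of (4.21) bounded by the left member of the p. 286 display AT HALF LOCALISATION RATE `δ₀/2`, from the
p. 282 first-order inputs only; hence (4.22) for the ACTUAL expansion (4.3) without the [15] Sect. G tree-decay input

statement-level skeleton of published theorems with citation tags; proofs where landed; nothing here is a claim about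
the Yang–Mills mass gap

PDF held: `paper:balaban1987-cmp109-rg-i-small-field` (journal page = PDF page + 248); p. 286 [PDF 38] and p. 282
[PDF 34] read from the text layer `~/.lit/texts/paper-balaban1987-cmp109-rg-i-small-field/p0038.txt`, `p0034.txt` and
the renders `run/shared/lean/pub/pub-balaban/b2b-balaban-ref1/pages/1987-cmp109-rg-I-small-field/…-p038-x2.png`,
`…-p034-x2.png`.

CITATION HEADER / WHAT IS REPRODUCED (mega-formalization `lit-balaban`, HOME `run/shared/lean/pub/lit-balaban/`; unit
`lit-balaban-p05` = Phase-2 proof seat, generation 9; SKELETON rows `B12.Eq4.21-4.22` (shared id; r20 file of record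
`B12Sect4Statements`, p239748), `B12.Txt@286a` (the two-case sentence, r09 display row), `B12.Disp@286`; free-target
protocol G.5-34(d); own lineage [Balaban1987RG1] = CMP 109 §4).

p. 286 [PDF 38], verbatim: *"Let us consider the second sum in (4.21). The function (∂B)(Γ_{x,x₃}) is localized also,
but now we have a function of two points instead of one. We apply the formula (4.3) and the inequality (4.5) properly
modified. The modification is connected with the fact that we have two localized functions δB and (∂B)(Γ_{x,x₃}), and
we have two cases to consider. In the first the points x, x₃ are connected with the same set N(p) in (4.3). Then the
exponential factor, with a length of a shortest tree graph in the exponent, yields the factor exp(−δ₀|x₃ − x|), and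
the product of it with |x₃ − x| is bounded by δ₀⁻¹. Thus we can take a sum over partitions with this property and
then sum over x, x₃ in arbitrary order. The second case is more complicated, the points x, x₃ are connected with
different sets in a partition … A term corresponding to such a partition can be estimated by
  Σ_{x,x₃} (8B₃ (1/α₂))⁴ E₀ exp(−κd_j(X) − δ₀ dist^{(ξ)}(X, x) − δ₀ dist^{(ξ)}(X, x₃)) |B|² |δB(x)| |(∂B)(Γ_{x,x₃})|
  < Σ_{x,x₃} (8B₃ (α₁/α₂))⁴ E₀ exp(−⅓κd_j(X) − δ₁|x − x₀| − δ₁|x₃ − x|) |x₃ − x| (L^jη)⁵ …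
Summing over x, x₃ we get finally the following estimate |(the second sum in (4.21))| ≦ (32B₃ (α₁/α₂) c₀(δ₁)c₁(δ₁))⁴
exp(−⅓κd_j(X)) (L^jη)⁵ (4.22)"*.  The inputs, p. 282 [PDF 34], verbatim: *"The norm in (4.4) of
⟨δ^{n(p)}/δB^{n(p)} 𝐇_j(□₀, 0), ⊗_{i∈N(p)} B_i⟩ can be estimated by B₃ Π_{i∈N(p)} |B_i|, and if one of the functions
B_i is localized outside X, e.g., in supp(1 − ζ̃_□), then we have the additional factor exp(−δ₀ dist^{(ξ)}(X, supp
B_i))."*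

WHAT THIS MODULE DOES (imports r20's `B12Term286DifferentBlocks` — hence r20's `B12Sect4Statements` (`PointData286`,
`PointData286.lhsSummand`, `Display286Printed`, `TermEstimate286Printed`, `KernelBound422Printed`,
`termEstimate286_of_pointwise`, `differentBlocks_summed_le`, `kernelBound422_of_terms`, `pow_blocks_le_pow_four`) and
p23 g4's `B2Lemma25Proof.l1dist` (the ℓ¹ distance on `ℤ^ν`),
pv12's `B12Ineq45` (`dirIter`, `term_bound`, `card_blocks_le`) / `B12Repr43` (`blockIns`, `blockSet`,
`iteratedFDeriv_apply_eq_dirIter`) and p05 g8's `B12Eq45LocalisedBlocks.norm_blockIns_le_localised`; modifies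
nothing; THEOREMS ONLY, no definition, no new named fact).

THE POINT.  In a partition `c` of the four arguments `B_0 = δB(x)`, `B_1 = B`, `B_2 = B`, `B_3 = (∂B)(Γ_{x,x₃})` of
the second sum of (4.21) in which `x, x₃` *"are connected with the same set N(p)"* (`c.index 0 = c.index 3`), the
block `N(p*) ∋ 0, 3` contains BOTH localised arguments, so the p. 282 sentence applies to it twice: the (4.4)-norm of
`⟨δ^{n(p*)}𝐇(0), ⊗_{i∈N(p*)}B_i⟩` carries the additional factor `exp(−δ₀dist^{(ξ)}(X, x))` AND the additional factor
`exp(−δ₀dist^{(ξ)}(X, x₃))` — each from the first-order localisation bound of its own argument (p05 g8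
`norm_blockIns_le_localised`; r20 g11 `term286_blockIns_le` keeps the first) — hence the factor
`min{e^{−δ₀dist(X,x)}, e^{−δ₀dist(X,x₃)}} ≤ e^{−(δ₀/2)dist(X,x)}·e^{−(δ₀/2)dist(X,x₃)}`.  Consequently a SAME-BLOCK term
obeys the left member of the p. 286 display with `δ₀` replaced by `δ₀/2` — the data `{D with δ₀ := D.δ₀/2}` — and the
whole second case machinery (display, lattice sums, the constant of (4.22)) applies to it unchanged:

* §0 four private [folklore] helpers: blocks of an ordered partition; `min{e^{−u}, e^{−v}} ≤ e^{−u/2}e^{−v/2}`;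
* §1 `blockIns_le_weight_x₃`, **`sameBlock_blockIns_le`** — the p. 282 bound of the block containing both localised
  arguments with the weight `e^{−(δ₀/2)dist(X,x)}e^{−(δ₀/2)dist(X,x₃)}`, for any `B₃ ≥ max{S_H, K}·max{1, 8/a}⁴`;
* §2 `sameBlock_term_le` (abstract directions, pv12 `term_bound` with ONE weighted block — the (4.5) pattern) and
  **`term286_sameBlock_le`** — for `c.index 0 = c.index 3`:
  `‖∂_{v_r}⋯∂_{v_1}𝐄(0)‖ ≤ {D with δ₀ := δ₀/2}.lhsSummand x x₃ =
   (8B₃α₂⁻¹)⁴E₀e^{−κd_j(X) − (δ₀/2)dist^{(ξ)}(X,x) − (δ₀/2)dist^{(ξ)}(X,x₃)}|B|²|δB(x)||(∂B)(Γ_{x,x₃})|`, the directions the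
  ACTUAL (4.3) insertions `blockIns H 0 B c`, every block hypothesis discharged from: `𝐄` analytic on an open
  `U ⊇ {‖𝐀‖ < α₂}` with `‖𝐄‖ ≤ E₀e^{−κd_j(X)}` ((4.4), (1.18)); `H = 𝐇_j(□₀,·)` analytic on an open `U_W ⊇ {‖·‖ < a}`
  with sup `S_H` ([15] Prop. 9); the two first-order localisation bounds of p. 282 ((190)-shape); the four sizes;
* §3 `norm_iteratedFDeriv_term286_sameBlock_le`, `termEstimate286_sameBlock` — the same as a Fréchet-derivative
  term of (4.3) and in r20's display-shape `TermEstimate286Printed {D with δ₀ := δ₀/2}`;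
* §4 `lhsSummand_le_half`, **`display286_of_half`** — the display at rate `δ₀/2` implies the printed display at rate
  `δ₀` (its left member only grows when `δ₀` is halved, its right member does not see `δ₀`);
  **`sameBlock_summed_actual`** — r20's by-reference hypothesis `hsame` of `kernelBound422_actual`, PROVED for every
  same-block partition from the display at `δ₀/2` and the lattice sums:
  `‖Σ_{x,x₃} D^{|c|}𝐄(0)[v(c; x, x₃)]‖ ≤ (8B₃α₁α₂⁻¹)⁴E₀c₀c₁e^{−⅓κd_j(X)}(L^jη)⁵`;
* §5 **`kernelBound422_actual_of_halfDisplay`** — (4.22) = r20's decl of record `KernelBound422Printed` for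
  `lhs2 := ‖Σ_{x,x₃} D⁴(𝐄∘𝐇)(0)[δB(x), B, B, (∂B)(Γ_{x,x₃})]‖`, BOTH families of partition terms derived: r20's
  `kernelBound422_actual` with its hypotheses `hD : Display286Printed D` and `hsame` (the [15] Sect. G input) REPLACED
  by the single hypothesis `Display286Printed {D with δ₀ := D.δ₀/2}`;
* §6 **`kernelBound422_actual_l1_of_halfDisplay`** — the same with the lattice-sum constants EXPLICIT,
  `c₀(δ₁) = (1 + 2/δ₁)^ν`, `c₁(δ₁) = (2/δ₁)(1 + 4/δ₁)^ν` for points located injectively on `ℤ^ν` (r20 g11 v1.2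
  `kernelBound422_actual_l1`, `latticeSum_c0_le`, `latticeSum_c1_le`), `hsame` removed likewise;
* §7 (v1.1, same unit and generation, APPEND-ONLY) `kernelBound422_of_terms_maxE₀`,
  **`kernelBound422_actual_of_halfDisplay_maxE₀`** — the bookkeeping hypothesis `E₀ ≤ 1` of r20's `kernelBound422_of_terms`
  ABSORBED into the located lattice constant `c₀′ = max{1, E₀}·c₀` (print's constant carries no `E₀`; fold owner r20's
  request 2026-08-21T23:33Z): (4.22) for the actual expansion concluded as `KernelBound422Printed ⟨lhs2, B₃, α₁, α₂,
  max{1,E₀}·c₀, c₁, κ, d_j(X), Lʲη⟩` with no condition on `E₀`.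

HONEST SCOPE.  (1) This is NOT the printed same-block argument.  Print bounds a same-block term through the [15]
Sect. G tree expansion of `⟨δ^{n(p)}𝐇(0), ⊗B_i⟩` (*"a tree graph with n(p) initial points and one final point"*,
p. 282), whose shortest tree through `x` and `x₃` *"yields the factor exp(−δ₀|x₃ − x|), and the product of it with
|x₃ − x| is bounded by δ₀⁻¹"* — a factor decaying in the separation `|x₃ − x|`, after which *"we … sum over x, x₃ in
arbitrary order"* WITHOUT the display (r20's hypothesis shapes `SameBlockFactor286Printed`, `sameBlock_product_le`;
the tree decay itself is cell GAPS G-B11-G2a and is not proved anywhere in the tree).  Here the same-block terms are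
routed through the SAME display as the different-blocks terms, at the halved rate: the two first-order (190)-shape
bounds give only `min` of the two localisation factors (a product would need second-order localisation = tree
decay), and `min ≤` geometric mean.  (2) Consequently (4.22) is reached for the actual expansion from: (4.4) +
(1.18), [15] Prop. 9 (analyticity and sup of `𝐇_j(□₀,·)`), the two first-order localisation bounds, the p. 286
display AT RATE `δ₀/2` (a printed display taken by reference, as in r20's file; p07 g10's `B12Display286RightMember`
derives its non-strict located form from (4.17)/(4.18)-type sizes and the site-lattice geometry for every `δ₀ > 0`,
so at `δ₀/2` with its `δ₁ = δ₁(δ₀/2, M)` — their knitting is the importers' business, this file imports r20 only), the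
lattice sums `c₀(δ₁)`, `c₁(δ₁)` and r20's bookkeeping `E₀ ≤ 1 ≤ c₀c₁`.  The printed constant `(32B₃α₁α₂⁻¹c₀c₁)⁴` keeps
its shape; which `δ₁` feeds `c₀, c₁` is not displayed in print (*"δ₁ = O(M⁻¹)"*).  (3) The constant `B₃`: any
`B₃ ≥ max{S_H, K}·max{1, 8/a}⁴` (the Cauchy-route constant of p05 g8 / r20 g11, cf. `B12Eq45BlockBound` HONEST SCOPE),
`8B₃ ≥ α₂`.  (4) `e^{−δ₀dist} ≤ 1` and the rate comparison use `δ₀·dist^{(ξ)}(X,·) ≥ 0` (hypotheses).  (5) Row heads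
do not move by this file alone (owners' call): the decl of record `KernelBound422Printed` is now inhabited for the
actual second sum of (4.21) modulo exactly `Display286Printed {D with δ₀ := δ₀/2}` + lattice sums + bookkeeping.
Every declaration below is a proved theorem; axioms standard.
-/

noncomputable section

open Set Metric Finset
open scoped BigOperators

namespace Literature.MathematicalPhysics.QuantumFieldTheory.Balaban1983to89.B12Term286SameBlock

open Literature.MathematicalPhysics.QuantumFieldTheory.Balaban1983to89
open B12Ineq45 B12Repr43 B12Sect4Statements B12Eq45BlockBound B12Eq45LocalisedBlocks B12Term286DifferentBlocks

variable {P : Type*}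
  {W : Type*} [NormedAddCommGroup W] [NormedSpace ℂ W]
  {E : Type*} [NormedAddCommGroup E] [NormedSpace ℂ E] [CompleteSpace E]
  {F : Type*} [NormedAddCommGroup F] [NormedSpace ℂ F] [CompleteSpace F]

/-! ## §0. Folklore: blocks of an ordered partition; the minimum of two exponential weights -/

/-- [folklore] A position lies in exactly one block: membership of `i` in the block `N(p)` forces `p` to be the index
of `i`. -/
private theorem eq_index_of_mem_blockSet {n : ℕ} (c : OrderedFinpartition n) {p : Fin c.length} {i : Fin n}
    (h : i ∈ blockSet c p) : p = c.index i := by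
  by_contra hne
  exact Finset.disjoint_left.1 (disjoint_blockSet c hne) h (mem_blockSet_index c i)

/-- [folklore] Membership in a block, read through its increasing parameterisation. -/
private theorem exists_emb_eq_of_mem_blockSet {n : ℕ} (c : OrderedFinpartition n) {p : Fin c.length} {i : Fin n}
    (h : i ∈ blockSet c p) : ∃ q, c.emb p q = i := by
  obtain ⟨q, -, hq⟩ := Finset.mem_image.1 h
  exact ⟨q, hq⟩

/-- [folklore] Blocks of an ordered partition are nonempty. -/
private theorem blockSet_nonempty {n : ℕ} (c : OrderedFinpartition n) (p : Fin c.length) :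
    (blockSet c p).Nonempty :=
  ⟨c.emb p ⟨0, c.partSize_pos p⟩, Finset.mem_image.2 ⟨⟨0, c.partSize_pos p⟩, Finset.mem_univ _, rfl⟩⟩

/-- [folklore] The minimum of two exponential weights is at most their geometric mean:
`min{e^{−u}, e^{−v}} ≤ e^{−u/2}·e^{−v/2}`. -/
private theorem min_exp_neg_le_half (u v : ℝ) :
    min (Real.exp (-u)) (Real.exp (-v)) ≤ Real.exp (-(u / 2)) * Real.exp (-(v / 2)) := by
  rw [← Real.exp_add]
  rcases le_total u v with h | h
  · exact (min_le_right _ _).trans (Real.exp_le_exp.2 (by linarith))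
  · exact (min_le_left _ _).trans (Real.exp_le_exp.2 (by linarith))

/-! ## §1. The p. 282 bound of the block containing BOTH localised arguments -/

/-- **p. 282 for the block of the `x₃`-localised argument** `B_3 = (∂B)(Γ_{x,x₃})`: every block insertion
`⟨δ^{n(p)}H(0), ⊗_{i∈N(p)}B_i⟩` of a partition `c` whose block `N(p)` contains the position `3` is bounded by
`e^{−δ₀dist^{(ξ)}(X,x₃)} · B₃ Π_{i∈N(p)} size_i` — whether or not `N(p)` also contains `0` — from the first-order
localisation bound of `B_3` (p05 g8 `norm_blockIns_le_localised`), for any `B₃ ≥ max{S_H, K}·max{1, 8/a}⁴`, `B₃ ≥ 0`.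
(r20 g11's `term286_blockIns_le` records, for a block containing `0`, the weight of `x` instead.)
[cite: Balaban1987RG1, p.282, p.286] -/
theorem blockIns_le_weight_x₃ (D : PointData286 P) (x x₃ : P)
    {UW : Set W} (hUW : IsOpen UW) {a SH K : ℝ} (ha : 0 < a) (hballW : ball (0 : W) a ⊆ UW)
    {H : W → E} (hH : AnalyticOnNhd ℂ H UW) (hK : 0 ≤ K)
    (B : Fin 4 → W) (hB0 : ‖B 0‖ ≤ D.δB x) (hB1 : ‖B 1‖ ≤ D.normB) (hB2 : ‖B 2‖ ≤ D.normB)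
    (hB3 : ‖B 3‖ ≤ D.dBΓ x x₃)
    (hlocx₃ : ∀ y ∈ ball (0 : W) a, ‖fderiv ℂ H y (B 3)‖ ≤ Real.exp (-(D.δ₀ * D.distX x₃)) * (K * ‖B 3‖))
    (hB₃ : max SH K * (max 1 (2 * (4 : ℝ) / a)) ^ 4 ≤ D.B₃) (hB₃0 : 0 ≤ D.B₃)
    (c : OrderedFinpartition 4) (p : Fin c.length) (h3 : (3 : Fin 4) ∈ blockSet c p) :
    ‖blockIns (𝕜 := ℂ) H 0 B c p‖ ≤ Real.exp (-(D.δ₀ * D.distX x₃)) *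
        (D.B₃ * ∏ i ∈ blockSet c p, (![D.δB x, D.normB, D.normB, D.dBΓ x x₃] : Fin 4 → ℝ) i) := by
  have hsz : ∀ i, ‖B i‖ ≤ (![D.δB x, D.normB, D.normB, D.dBΓ x x₃] : Fin 4 → ℝ) i := by
    intro i
    fin_cases i
    · simpa using hB0
    · simpa using hB1
    · simpa using hB2
    · simpa using hB3
  have hprod : ∏ q, ‖B (c.emb p q)‖ ≤
      ∏ i ∈ blockSet c p, (![D.δB x, D.normB, D.normB, D.dBΓ x x₃] : Fin 4 → ℝ) i := by
    rw [prod_blockSet c p]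
    exact Finset.prod_le_prod (fun _ _ => norm_nonneg _) fun q _ => hsz _
  have hP0 : 0 ≤ ∏ q, ‖B (c.emb p q)‖ := Finset.prod_nonneg fun _ _ => norm_nonneg _
  have hM0 : 0 ≤ (max 1 (2 * (4 : ℝ) / a)) ^ 4 := pow_nonneg (zero_le_one.trans (le_max_left _ _)) _
  have hKB : K * (max 1 (2 * (4 : ℝ) / a)) ^ 4 ≤ D.B₃ :=
    (mul_le_mul_of_nonneg_right (le_max_right SH K) hM0).trans hB₃
  obtain ⟨q, hq⟩ := exists_emb_eq_of_mem_blockSet c h3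
  have h := norm_blockIns_le_localised hUW ha hballW hH B (fun i => i = 3) (Real.exp_nonneg _) hK
    (fun i hi y hy => by subst hi; exact hlocx₃ y hy) c p ⟨q, hq⟩
  simp only [Nat.cast_ofNat] at h
  refine h.trans (mul_le_mul_of_nonneg_left ?_ (Real.exp_nonneg _))
  calc K * (max 1 (2 * (4 : ℝ) / a)) ^ 4 * ∏ q, ‖B (c.emb p q)‖
      ≤ D.B₃ * ∏ q, ‖B (c.emb p q)‖ := mul_le_mul_of_nonneg_right hKB hP0
    _ ≤ D.B₃ * ∏ i ∈ blockSet c p, (![D.δB x, D.normB, D.normB, D.dBΓ x x₃] : Fin 4 → ℝ) i :=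
        mul_le_mul_of_nonneg_left hprod hB₃0

/-- **The p. 282 sentence applied TWICE to the block containing both localised arguments.**  If the block `N(p)` of
a partition `c` of the four arguments of (4.21) contains BOTH `0` (the position of `δB(x)`, localised at `x`) and `3`
(the position of `(∂B)(Γ_{x,x₃})`, localised at `x₃`), then its insertion carries both additional factors, one at a
time — hence their minimum, hence the geometric mean:
`‖⟨δ^{n(p)}H(0), ⊗_{i∈N(p)}B_i⟩‖ ≤ e^{−(δ₀/2)dist^{(ξ)}(X,x)}·e^{−(δ₀/2)dist^{(ξ)}(X,x₃)} · B₃ Π_{i∈N(p)} size_i`.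
Inputs: `H = 𝐇_j(□₀,·)` analytic on an open `U_W ⊇ {‖·‖ < a}` with sup `S_H` ([15] Prop. 9), the two first-order
localisation bounds of p. 282, the sizes, `B₃ ≥ max{S_H, K}·max{1, 8/a}⁴`. [cite: Balaban1987RG1, p.282, p.286] -/
theorem sameBlock_blockIns_le (D : PointData286 P) (x x₃ : P)
    {UW : Set W} (hUW : IsOpen UW) {a SH K : ℝ} (ha : 0 < a) (hballW : ball (0 : W) a ⊆ UW)
    {H : W → E} (hH : AnalyticOnNhd ℂ H UW) (hSH : ∀ y ∈ ball (0 : W) a, ‖H y‖ ≤ SH) (hK : 0 ≤ K)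
    (B : Fin 4 → W) (hB0 : ‖B 0‖ ≤ D.δB x) (hB1 : ‖B 1‖ ≤ D.normB) (hB2 : ‖B 2‖ ≤ D.normB)
    (hB3 : ‖B 3‖ ≤ D.dBΓ x x₃)
    (hlocx : ∀ y ∈ ball (0 : W) a, ‖fderiv ℂ H y (B 0)‖ ≤ Real.exp (-(D.δ₀ * D.distX x)) * (K * ‖B 0‖))
    (hlocx₃ : ∀ y ∈ ball (0 : W) a, ‖fderiv ℂ H y (B 3)‖ ≤ Real.exp (-(D.δ₀ * D.distX x₃)) * (K * ‖B 3‖))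
    (hB₃ : max SH K * (max 1 (2 * (4 : ℝ) / a)) ^ 4 ≤ D.B₃) (hB₃0 : 0 ≤ D.B₃)
    (c : OrderedFinpartition 4) (p : Fin c.length) (h0 : (0 : Fin 4) ∈ blockSet c p)
    (h3 : (3 : Fin 4) ∈ blockSet c p) :
    ‖blockIns (𝕜 := ℂ) H 0 B c p‖ ≤
      (Real.exp (-(D.δ₀ / 2 * D.distX x)) * Real.exp (-(D.δ₀ / 2 * D.distX x₃))) *
        (D.B₃ * ∏ i ∈ blockSet c p, (![D.δB x, D.normB, D.normB, D.dBΓ x x₃] : Fin 4 → ℝ) i) := by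
  set M : ℝ := D.B₃ * ∏ i ∈ blockSet c p, (![D.δB x, D.normB, D.normB, D.dBΓ x x₃] : Fin 4 → ℝ) i with hMdef
  -- the weight of `x`: r20's `term286_blockIns_le` (its first branch)
  have hx : ‖blockIns (𝕜 := ℂ) H 0 B c p‖ ≤ Real.exp (-(D.δ₀ * D.distX x)) * M := by
    have h := term286_blockIns_le D x x₃ hUW ha hballW hH hSH hK B hB0 hB1 hB2 hB3 hlocx hlocx₃ hB₃ hB₃0 c p
    rwa [if_pos h0] at h
  -- the weight of `x₃`
  have hx₃ : ‖blockIns (𝕜 := ℂ) H 0 B c p‖ ≤ Real.exp (-(D.δ₀ * D.distX x₃)) * M :=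
    blockIns_le_weight_x₃ D x x₃ hUW ha hballW hH hK B hB0 hB1 hB2 hB3 hlocx₃ hB₃ hB₃0 c p h3
  have hM : 0 ≤ M := by
    have hsz : ∀ i, 0 ≤ (![D.δB x, D.normB, D.normB, D.dBΓ x x₃] : Fin 4 → ℝ) i := by
      intro i
      fin_cases i
      · simpa using (norm_nonneg _).trans hB0
      · simpa using (norm_nonneg _).trans hB1
      · simpa using (norm_nonneg _).trans hB2
      · simpa using (norm_nonneg _).trans hB3
    exact mul_nonneg hB₃0 (Finset.prod_nonneg fun i _ => hsz i)
  have hmin : ‖blockIns (𝕜 := ℂ) H 0 B c p‖ ≤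
      min (Real.exp (-(D.δ₀ * D.distX x))) (Real.exp (-(D.δ₀ * D.distX x₃))) * M := by
    rw [min_mul_of_nonneg _ _ hM]
    exact le_min hx hx₃
  refine hmin.trans (mul_le_mul_of_nonneg_right ?_ hM)
  have h := min_exp_neg_le_half (D.δ₀ * D.distX x) (D.δ₀ * D.distX x₃)
  rwa [mul_div_right_comm, mul_div_right_comm] at h

/-! ## §2. The same-block term estimate: the left member of the display at rate `δ₀/2` -/

omit [CompleteSpace E] in
/-- **One SAME-BLOCK term, abstract directions — the (4.5) pattern with ONE weighted block** (pv12 `term_bound`).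
Hypotheses by name, at fixed points `x, x₃`: `f = 𝐀 ↦ 𝐄^{(j)}(X, exp iξ𝐀)` holomorphic on an open `U ⊇ {‖𝐀‖ < α₂}`
with `‖f‖ ≤ E₀e^{−κd_j(X)}` there ((4.4), (1.18)); the four arguments of the second sum of (4.21) with sizes
`|δB(x)|, |B|, |B|, |(∂B)(Γ_{x,x₃})|`, partitioned into the blocks `N(p)` of (4.3); directions `v_p` with the p. 282
bounds `‖v_p‖ ≤ w_p · B₃ Π_{i∈N(p)} size_i`, weights `w_p ∈ [0,1]`, the block `p₀` containing both localised arguments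
weighted by `e^{−(δ₀/2)dist^{(ξ)}(X,x)}·e^{−(δ₀/2)dist^{(ξ)}(X,x₃)}` (`sameBlock_blockIns_le`); `8B₃ ≥ α₂`.  Conclusion:
the term `∂ʳ/∂τ₁…∂τ_r f(Σ_p τ_p v_p)|_{τ=0}` is at most the `(x, x₃)` summand of the left member of the p. 286 display
with `δ₀` replaced by `δ₀/2`. [cite: Balaban1987RG1, p.286; (4.3)–(4.5) pp.281–282] -/
theorem sameBlock_term_le (D : PointData286 P) (x x₃ : P)
    {U : Set E} (hU : IsOpen U) (hα : 0 < D.α₂) (hB : D.α₂ ≤ 8 * D.B₃) (hball : ball (0 : E) D.α₂ ⊆ U)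
    {f : E → F} (hf : DifferentiableOn ℂ f U)
    (hS : ∀ y ∈ ball (0 : E) D.α₂, ‖f y‖ ≤ D.E₀ * Real.exp (-(D.κ * D.djX)))
    (hnormB : 0 ≤ D.normB) (hδB : 0 ≤ D.δB x) (hdBΓ : 0 ≤ D.dBΓ x x₃)
    {r : ℕ} (N : Fin r → Finset (Fin 4)) (hdisj : ∀ p q, p ≠ q → Disjoint (N p) (N q))
    (hcov : Finset.univ.biUnion N = Finset.univ) (hne : ∀ p, (N p).Nonempty)
    (w : Fin r → ℝ) (hw0 : ∀ p, 0 ≤ w p) (hw1 : ∀ p, w p ≤ 1) (p₀ : Fin r)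
    (hwp₀ : w p₀ ≤ Real.exp (-(D.δ₀ / 2 * D.distX x)) * Real.exp (-(D.δ₀ / 2 * D.distX x₃)))
    (v : Fin r → E)
    (hv : ∀ p, ‖v p‖ ≤ w p * (D.B₃ * ∏ i ∈ N p, ![D.δB x, D.normB, D.normB, D.dBΓ x x₃] i)) :
    ‖dirIter r v f 0‖ ≤ ({ D with δ₀ := D.δ₀ / 2 } : PointData286 P).lhsSummand x x₃ := by
  have hB₃ : 0 ≤ D.B₃ := by linarith
  have hb0 : ∀ i, 0 ≤ (![D.δB x, D.normB, D.normB, D.dBΓ x x₃] : Fin 4 → ℝ) i := by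
    intro i
    fin_cases i
    · simpa using hδB
    · simpa using hnormB
    · simpa using hnormB
    · simpa using hdBΓ
  have h1 := term_bound hU hα hball hf hS hB₃ N hdisj hcov
    (![D.δB x, D.normB, D.normB, D.dBΓ x x₃]) hb0 w hw0 hw1 v hv p₀
  have hr : r ≤ 4 := by simpa using card_blocks_le N hdisj hcov hne
  have hpow := pow_blocks_le_pow_four hr hα hB
  have hS0 : 0 ≤ D.E₀ * Real.exp (-(D.κ * D.djX)) := (norm_nonneg _).trans (hS 0 (mem_ball_self hα))
  have hP0 : 0 ≤ ∏ i, (![D.δB x, D.normB, D.normB, D.dBΓ x x₃] : Fin 4 → ℝ) i :=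
    Finset.prod_nonneg fun i _ => hb0 i
  have hprod : ∏ i, (![D.δB x, D.normB, D.normB, D.dBΓ x x₃] : Fin 4 → ℝ) i =
      D.δB x * D.normB * D.normB * D.dBΓ x x₃ := by
    rw [Fin.prod_univ_four]
    simp
  have step : D.E₀ * Real.exp (-(D.κ * D.djX)) * (2 * (r : ℝ) * D.B₃ / D.α₂) ^ r * w p₀ *
        ∏ i, (![D.δB x, D.normB, D.normB, D.dBΓ x x₃] : Fin 4 → ℝ) i ≤
      D.E₀ * Real.exp (-(D.κ * D.djX)) * (8 * D.B₃ / D.α₂) ^ 4 *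
        (Real.exp (-(D.δ₀ / 2 * D.distX x)) * Real.exp (-(D.δ₀ / 2 * D.distX x₃))) *
        ∏ i, (![D.δB x, D.normB, D.normB, D.dBΓ x x₃] : Fin 4 → ℝ) i := by
    apply mul_le_mul_of_nonneg_right _ hP0
    apply mul_le_mul _ hwp₀ (hw0 _)
    · exact mul_nonneg hS0 (pow_nonneg (by positivity) _)
    · exact mul_le_mul_of_nonneg_left hpow hS0
  calc ‖dirIter r v f 0‖ ≤ _ := h1
    _ ≤ _ := step
    _ = ({ D with δ₀ := D.δ₀ / 2 } : PointData286 P).lhsSummand x x₃ := by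
        rw [hprod, PointData286.lhsSummand_eq]

/-- **p. 286, the FIRST case, for ONE term of (4.3) — bounded by the left member of the display at rate `δ₀/2`, the
p. 282 block bounds DERIVED.**  *"In the first [case] the points x, x₃ are connected with the same set N(p) in
(4.3)"* (`c.index 0 = c.index 3`).  Hypotheses, all printed inputs by reference: the outer function
`𝐄 = 𝐀 ↦ 𝐄^{(j)}(X, exp iξ𝐀)` analytic on an open `U ⊇ {‖𝐀‖ < α₂}` ((4.4) p. 281) with `‖𝐄‖ ≤ E₀e^{−κd_j(X)}` there
((1.18) p. 263); the inner map `H = 𝐇_j(□₀,·)` analytic on an open `U_W ⊇ {‖·‖ < a}` with `‖H‖ ≤ S_H` ([15]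
Prop. 9); the sizes of the four arguments of (4.21); the first-order localisation bounds of p. 282 for `δB(x)` and
`(∂B)(Γ_{x,x₃})`; `B₃ ≥ max{S_H, K}·max{1, 8/a}⁴`, `8B₃ ≥ α₂`, `δ₀dist ≥ 0`.  Conclusion: the `c`-term
`∂_{v_r}⋯∂_{v_1}𝐄(0)`, `v_p = ⟨δ^{n(p)}𝐇(0), ⊗_{i∈N(p)}B_i⟩`, is at most
`(8B₃α₂⁻¹)⁴E₀e^{−κd_j(X) − (δ₀/2)dist^{(ξ)}(X,x) − (δ₀/2)dist^{(ξ)}(X,x₃)}|B|²|δB(x)||(∂B)(Γ_{x,x₃})|` = the `(x, x₃)` summand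
of the printed left member for the data `{D with δ₀ := δ₀/2}`.  (Print's own route for this case is the [15]
Sect. G tree decay, factor `e^{−δ₀|x₃ − x|}` — HONEST SCOPE (1).)
[cite: Balaban1987RG1, p.286; (4.3)–(4.5) pp.281–282; (1.18) p.263] -/
theorem term286_sameBlock_le (D : PointData286 P) (x x₃ : P)
    {U : Set E} (hU : IsOpen U) (hα : 0 < D.α₂) (hαB : D.α₂ ≤ 8 * D.B₃) (hball : ball (0 : E) D.α₂ ⊆ U)
    {f : E → F} (hf : AnalyticOnNhd ℂ f U)
    (hS : ∀ y ∈ ball (0 : E) D.α₂, ‖f y‖ ≤ D.E₀ * Real.exp (-(D.κ * D.djX)))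
    {UW : Set W} (hUW : IsOpen UW) {a SH K : ℝ} (ha : 0 < a) (hballW : ball (0 : W) a ⊆ UW)
    {H : W → E} (hH : AnalyticOnNhd ℂ H UW) (hSH : ∀ y ∈ ball (0 : W) a, ‖H y‖ ≤ SH) (hK : 0 ≤ K)
    (B : Fin 4 → W) (hB0 : ‖B 0‖ ≤ D.δB x) (hB1 : ‖B 1‖ ≤ D.normB) (hB2 : ‖B 2‖ ≤ D.normB)
    (hB3 : ‖B 3‖ ≤ D.dBΓ x x₃) (hδx : 0 ≤ D.δ₀ * D.distX x) (hδx₃ : 0 ≤ D.δ₀ * D.distX x₃)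
    (hlocx : ∀ y ∈ ball (0 : W) a, ‖fderiv ℂ H y (B 0)‖ ≤ Real.exp (-(D.δ₀ * D.distX x)) * (K * ‖B 0‖))
    (hlocx₃ : ∀ y ∈ ball (0 : W) a, ‖fderiv ℂ H y (B 3)‖ ≤ Real.exp (-(D.δ₀ * D.distX x₃)) * (K * ‖B 3‖))
    (hB₃ : max SH K * (max 1 (2 * (4 : ℝ) / a)) ^ 4 ≤ D.B₃)
    (c : OrderedFinpartition 4) (hc : c.index 0 = c.index 3) :
    ‖dirIter c.length (fun p => blockIns (𝕜 := ℂ) H 0 B c (Fin.rev p)) f 0‖ ≤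
      ({ D with δ₀ := D.δ₀ / 2 } : PointData286 P).lhsSummand x x₃ := by
  have hB₃0 : 0 ≤ D.B₃ := by linarith
  have h0mem : (0 : Fin 4) ∈ blockSet c (c.index 0) := mem_blockSet_index c 0
  have h3mem : (3 : Fin 4) ∈ blockSet c (c.index 0) := hc ▸ mem_blockSet_index c 3
  -- the weight of a block: the geometric mean of the two localisation factors on the block holding `δB(x)` and
  -- `(∂B)(Γ_{x,x₃})`, `1` on the others
  obtain ⟨wt, hwt0, hwt1, hw0, hins⟩ : ∃ wt : Fin c.length → ℝ, (∀ p, 0 ≤ wt p) ∧ (∀ p, wt p ≤ 1) ∧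
      wt (c.index 0) = Real.exp (-(D.δ₀ / 2 * D.distX x)) * Real.exp (-(D.δ₀ / 2 * D.distX x₃)) ∧
      ∀ p, ‖blockIns (𝕜 := ℂ) H 0 B c p‖ ≤
        wt p * (D.B₃ * ∏ i ∈ blockSet c p, (![D.δB x, D.normB, D.normB, D.dBΓ x x₃] : Fin 4 → ℝ) i) := by
    refine ⟨fun p => if (0 : Fin 4) ∈ blockSet c p then
        Real.exp (-(D.δ₀ / 2 * D.distX x)) * Real.exp (-(D.δ₀ / 2 * D.distX x₃)) else 1,
      fun p => ?_, fun p => ?_, ?_, fun p => ?_⟩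
    · dsimp only
      split_ifs <;> positivity
    · dsimp only
      split_ifs
      · rw [← Real.exp_add]
        exact Real.exp_le_one_iff.2 (by linarith)
      · exact le_rfl
    · dsimp only
      rw [if_pos h0mem]
    · dsimp only
      by_cases h0 : (0 : Fin 4) ∈ blockSet c p
      · -- the block holding both localised arguments
        rw [if_pos h0]
        have hp : p = c.index 0 := eq_index_of_mem_blockSet c h0
        subst hp
        exact sameBlock_blockIns_le D x x₃ hUW ha hballW hH hSH hK B hB0 hB1 hB2 hB3 hlocx hlocx₃ hB₃ hB₃0 c _
          h0mem h3mem
      · -- a block without localised arguments (`3 ∈ N(p)` would force `p = index 3 = index 0 ∋ 0`)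
        rw [if_neg h0]
        have h3 : (3 : Fin 4) ∉ blockSet c p := fun h => by
          have hp : p = c.index 0 := (eq_index_of_mem_blockSet c h).trans hc.symm
          exact h0 (hp ▸ h0mem)
        have h := term286_blockIns_le D x x₃ hUW ha hballW hH hSH hK B hB0 hB1 hB2 hB3 hlocx hlocx₃ hB₃ hB₃0 c p
        rwa [if_neg h0, if_neg h3] at h
  have hnormB : 0 ≤ D.normB := (norm_nonneg _).trans hB1
  have hδB : 0 ≤ D.δB x := (norm_nonneg _).trans hB0
  have hdBΓ : 0 ≤ D.dBΓ x x₃ := (norm_nonneg _).trans hB3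
  exact sameBlock_term_le D x x₃ hU hα hαB hball hf.differentiableOn hS hnormB hδB hdBΓ
    (fun p => blockSet c (Fin.rev p))
    (fun p q hpq => disjoint_blockSet c fun h => hpq (Fin.rev_injective h))
    (biUnion_blockSet_comp_equiv c Fin.revPerm) (fun p => blockSet_nonempty c _)
    (fun p => wt (Fin.rev p)) (fun p => hwt0 _) (fun p => hwt1 _) (Fin.rev (c.index 0))
    (by simp only [Fin.rev_rev, hw0, le_refl])
    (fun p => blockIns (𝕜 := ℂ) H 0 B c (Fin.rev p)) (fun p => hins _)

/-! ## §3. The same term as a Fréchet derivative of (4.3); the display-shape `TermEstimate286Printed` at `δ₀/2` -/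

/-- **The same-block term written as in (4.3)**: the Fréchet derivative `D^{|c|}𝐄(0)[⟨δ^{n(p)}𝐇(0), ⊗_{i∈N(p)}B_i⟩_{p}]`
(pv12's `iteratedFDeriv_apply_eq_dirIter`) is at most `{D with δ₀ := δ₀/2}.lhsSummand x x₃` under the hypotheses of
`term286_sameBlock_le`. [cite: Balaban1987RG1, p.286; (4.3) p.281] -/
theorem norm_iteratedFDeriv_term286_sameBlock_le (D : PointData286 P) (x x₃ : P)
    {U : Set E} (hU : IsOpen U) (hα : 0 < D.α₂) (hαB : D.α₂ ≤ 8 * D.B₃) (hball : ball (0 : E) D.α₂ ⊆ U)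
    {f : E → F} (hf : AnalyticOnNhd ℂ f U)
    (hS : ∀ y ∈ ball (0 : E) D.α₂, ‖f y‖ ≤ D.E₀ * Real.exp (-(D.κ * D.djX)))
    {UW : Set W} (hUW : IsOpen UW) {a SH K : ℝ} (ha : 0 < a) (hballW : ball (0 : W) a ⊆ UW)
    {H : W → E} (hH : AnalyticOnNhd ℂ H UW) (hSH : ∀ y ∈ ball (0 : W) a, ‖H y‖ ≤ SH) (hK : 0 ≤ K)
    (B : Fin 4 → W) (hB0 : ‖B 0‖ ≤ D.δB x) (hB1 : ‖B 1‖ ≤ D.normB) (hB2 : ‖B 2‖ ≤ D.normB)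
    (hB3 : ‖B 3‖ ≤ D.dBΓ x x₃) (hδx : 0 ≤ D.δ₀ * D.distX x) (hδx₃ : 0 ≤ D.δ₀ * D.distX x₃)
    (hlocx : ∀ y ∈ ball (0 : W) a, ‖fderiv ℂ H y (B 0)‖ ≤ Real.exp (-(D.δ₀ * D.distX x)) * (K * ‖B 0‖))
    (hlocx₃ : ∀ y ∈ ball (0 : W) a, ‖fderiv ℂ H y (B 3)‖ ≤ Real.exp (-(D.δ₀ * D.distX x₃)) * (K * ‖B 3‖))
    (hB₃ : max SH K * (max 1 (2 * (4 : ℝ) / a)) ^ 4 ≤ D.B₃)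
    (c : OrderedFinpartition 4) (hc : c.index 0 = c.index 3) :
    ‖iteratedFDeriv ℂ c.length f 0 (blockIns (𝕜 := ℂ) H 0 B c)‖ ≤
      ({ D with δ₀ := D.δ₀ / 2 } : PointData286 P).lhsSummand x x₃ := by
  have h0 : (0 : E) ∈ U := hball (mem_ball_self hα)
  rw [iteratedFDeriv_apply_eq_dirIter hU (hf.contDiffOn_of_completeSpace (n := c.length)) h0]
  exact term286_sameBlock_le D x x₃ hU hα hαB hball hf hS hUW ha hballW hH hSH hK B hB0 hB1 hB2 hB3 hδx hδx₃
    hlocx hlocx₃ hB₃ c hc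

/-- **The same-block family in r20's display-shape** `TermEstimate286Printed {D with δ₀ := δ₀/2}`: the term of a
same-block partition `c`, *"with the summations over x, x₃ left undone"*, summed in norm against the left member of
the p. 286 display at rate `δ₀/2`, for the ACTUAL (4.3) terms with the `(x, x₃)`-localised arguments `B x x₃`, every
block hypothesis discharged (pointwise `norm_iteratedFDeriv_term286_sameBlock_le` + r20's
`termEstimate286_of_pointwise`). [cite: Balaban1987RG1, p.286] -/
theorem termEstimate286_sameBlock [Fintype P] (D : PointData286 P)
    {U : Set E} (hU : IsOpen U) (hα : 0 < D.α₂) (hαB : D.α₂ ≤ 8 * D.B₃) (hball : ball (0 : E) D.α₂ ⊆ U)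
    {f : E → F} (hf : AnalyticOnNhd ℂ f U)
    (hS : ∀ y ∈ ball (0 : E) D.α₂, ‖f y‖ ≤ D.E₀ * Real.exp (-(D.κ * D.djX)))
    {UW : Set W} (hUW : IsOpen UW) {a SH K : ℝ} (ha : 0 < a) (hballW : ball (0 : W) a ⊆ UW)
    {H : W → E} (hH : AnalyticOnNhd ℂ H UW) (hSH : ∀ y ∈ ball (0 : W) a, ‖H y‖ ≤ SH) (hK : 0 ≤ K)
    (B : P → P → Fin 4 → W) (hB0 : ∀ x x₃, ‖B x x₃ 0‖ ≤ D.δB x) (hB1 : ∀ x x₃, ‖B x x₃ 1‖ ≤ D.normB)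
    (hB2 : ∀ x x₃, ‖B x x₃ 2‖ ≤ D.normB) (hB3 : ∀ x x₃, ‖B x x₃ 3‖ ≤ D.dBΓ x x₃)
    (hδ : ∀ x, 0 ≤ D.δ₀ * D.distX x)
    (hlocx : ∀ x x₃, ∀ y ∈ ball (0 : W) a,
      ‖fderiv ℂ H y (B x x₃ 0)‖ ≤ Real.exp (-(D.δ₀ * D.distX x)) * (K * ‖B x x₃ 0‖))
    (hlocx₃ : ∀ x x₃, ∀ y ∈ ball (0 : W) a,
      ‖fderiv ℂ H y (B x x₃ 3)‖ ≤ Real.exp (-(D.δ₀ * D.distX x₃)) * (K * ‖B x x₃ 3‖))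
    (hB₃ : max SH K * (max 1 (2 * (4 : ℝ) / a)) ^ 4 ≤ D.B₃)
    (c : OrderedFinpartition 4) (hc : c.index 0 = c.index 3) :
    TermEstimate286Printed ({ D with δ₀ := D.δ₀ / 2 } : PointData286 P)
      (fun x x₃ => iteratedFDeriv ℂ c.length f 0 (blockIns (𝕜 := ℂ) H 0 (B x x₃) c)) :=
  termEstimate286_of_pointwise _ _ fun x x₃ =>
    norm_iteratedFDeriv_term286_sameBlock_le D x x₃ hU hα hαB hball hf hS hUW ha hballW hH hSH hK (B x x₃)
      (hB0 x x₃) (hB1 x x₃) (hB2 x x₃) (hB3 x x₃) (hδ x) (hδ x₃) (hlocx x x₃) (hlocx₃ x x₃) hB₃ c hc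

/-! ## §4. The display at rate `δ₀/2` ⇒ the display at rate `δ₀`; the same-block family summed -/

/-- Halving the localisation rate only enlarges the left summand of the p. 286 display (for `δ₀dist ≥ 0` and
non-negative sizes and `E₀`): `D.lhsSummand x x₃ ≤ {D with δ₀ := δ₀/2}.lhsSummand x x₃`. [cite: Balaban1987RG1, p.286] -/
theorem lhsSummand_le_half (D : PointData286 P) (x x₃ : P) (hE₀ : 0 ≤ D.E₀) (hδB : 0 ≤ D.δB x)
    (hdBΓ : 0 ≤ D.dBΓ x x₃) (hδx : 0 ≤ D.δ₀ * D.distX x) (hδx₃ : 0 ≤ D.δ₀ * D.distX x₃) :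
    D.lhsSummand x x₃ ≤ ({ D with δ₀ := D.δ₀ / 2 } : PointData286 P).lhsSummand x x₃ := by
  rw [D.lhsSummand_eq, PointData286.lhsSummand_eq]
  dsimp only
  have h8 : 0 ≤ (8 * D.B₃ / D.α₂) ^ 4 := Even.pow_nonneg ⟨2, by norm_num⟩ _
  have hA : 0 ≤ D.E₀ * Real.exp (-(D.κ * D.djX)) * (8 * D.B₃ / D.α₂) ^ 4 :=
    mul_nonneg (mul_nonneg hE₀ (Real.exp_pos _).le) h8
  have hS : 0 ≤ D.δB x * D.normB * D.normB * D.dBΓ x x₃ := by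
    have : 0 ≤ D.δB x * (D.normB * D.normB) * D.dBΓ x x₃ :=
      mul_nonneg (mul_nonneg hδB (mul_self_nonneg _)) hdBΓ
    simpa [mul_assoc] using this
  have hw : Real.exp (-(D.δ₀ * D.distX x)) * Real.exp (-(D.δ₀ * D.distX x₃)) ≤
      Real.exp (-(D.δ₀ / 2 * D.distX x)) * Real.exp (-(D.δ₀ / 2 * D.distX x₃)) := by
    refine mul_le_mul (Real.exp_le_exp.2 ?_) (Real.exp_le_exp.2 ?_) (Real.exp_pos _).le (Real.exp_pos _).le
    · have : D.δ₀ / 2 * D.distX x = D.δ₀ * D.distX x / 2 := by ring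
      rw [this]; linarith
    · have : D.δ₀ / 2 * D.distX x₃ = D.δ₀ * D.distX x₃ / 2 := by ring
      rw [this]; linarith
  exact mul_le_mul_of_nonneg_right (mul_le_mul_of_nonneg_left hw hA) hS

/-- **The display at rate `δ₀/2` implies the printed display** (at rate `δ₀`): the left member grows termwise when
`δ₀` is halved (`lhsSummand_le_half`), the right member `(8B₃α₁α₂⁻¹)⁴E₀e^{−⅓κd_j(X) − δ₁|x−x₀| − δ₁|x₃−x|}|x₃−x|(L^jη)⁵`
does not involve `δ₀`.  (Hypotheses: `E₀ ≥ 0`, sizes `≥ 0`, `δ₀dist ≥ 0`.) [cite: Balaban1987RG1, p.286] -/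
theorem display286_of_half [Fintype P] (D : PointData286 P) (hE₀ : 0 ≤ D.E₀) (hδB : ∀ x, 0 ≤ D.δB x)
    (hdBΓ : ∀ x x₃, 0 ≤ D.dBΓ x x₃) (hδ : ∀ x, 0 ≤ D.δ₀ * D.distX x)
    (hD : Display286Printed ({ D with δ₀ := D.δ₀ / 2 } : PointData286 P)) : Display286Printed D := by
  unfold Display286Printed at hD ⊢
  have hl : ∑ x, ∑ x₃, D.lhsSummand x x₃ ≤
      ∑ x, ∑ x₃, ({ D with δ₀ := D.δ₀ / 2 } : PointData286 P).lhsSummand x x₃ :=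
    Finset.sum_le_sum fun x _ => Finset.sum_le_sum fun x₃ _ =>
      lhsSummand_le_half D x x₃ hE₀ (hδB x) (hdBΓ x x₃) (hδ x) (hδ x₃)
  have hr : ∑ x, ∑ x₃, ({ D with δ₀ := D.δ₀ / 2 } : PointData286 P).rhsSummand x x₃ =
      ∑ x, ∑ x₃, D.rhsSummand x x₃ := by
    rfl
  exact hl.trans_lt (hD.trans_eq hr)

/-- **The same-block family SUMMED — r20's by-reference hypothesis `hsame` of `kernelBound422_actual`, PROVED from the
display at rate `δ₀/2`.**  For a same-block partition `c` (`c.index 0 = c.index 3`) of the four arguments of the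
second sum of (4.21): the term estimate at rate `δ₀/2` (`termEstimate286_sameBlock`), the p. 286 display for the data
`{D with δ₀ := δ₀/2}` (a printed display, by reference) and the lattice sums `c₀(δ₁) ≥ Σ_x e^{−δ₁|x−x₀|}`,
`c₁(δ₁) ≥ Σ_{x₃} e^{−δ₁|x₃−x|}|x₃−x|` give
`‖Σ_{x,x₃} D^{|c|}𝐄(0)[v(c; x, x₃)]‖ ≤ (8B₃α₁α₂⁻¹)⁴E₀c₀c₁e^{−⅓κd_j(X)}(L^jη)⁵` (r20's `differentBlocks_summed_le`, whose
arithmetic does not see `δ₀`). [cite: Balaban1987RG1, p.286, (4.22)] -/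
theorem sameBlock_summed_actual [Fintype P] (D : PointData286 P)
    {U : Set E} (hU : IsOpen U) (hα : 0 < D.α₂) (hαB : D.α₂ ≤ 8 * D.B₃) (hball : ball (0 : E) D.α₂ ⊆ U)
    {f : E → F} (hf : AnalyticOnNhd ℂ f U)
    (hS : ∀ y ∈ ball (0 : E) D.α₂, ‖f y‖ ≤ D.E₀ * Real.exp (-(D.κ * D.djX)))
    {UW : Set W} (hUW : IsOpen UW) {a SH K : ℝ} (ha : 0 < a) (hballW : ball (0 : W) a ⊆ UW)
    {H : W → E} (hH : AnalyticOnNhd ℂ H UW) (hSH : ∀ y ∈ ball (0 : W) a, ‖H y‖ ≤ SH) (hK : 0 ≤ K)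
    (B : P → P → Fin 4 → W) (hB0 : ∀ x x₃, ‖B x x₃ 0‖ ≤ D.δB x) (hB1 : ∀ x x₃, ‖B x x₃ 1‖ ≤ D.normB)
    (hB2 : ∀ x x₃, ‖B x x₃ 2‖ ≤ D.normB) (hB3 : ∀ x x₃, ‖B x x₃ 3‖ ≤ D.dBΓ x x₃)
    (hδ : ∀ x, 0 ≤ D.δ₀ * D.distX x)
    (hlocx : ∀ x x₃, ∀ y ∈ ball (0 : W) a,
      ‖fderiv ℂ H y (B x x₃ 0)‖ ≤ Real.exp (-(D.δ₀ * D.distX x)) * (K * ‖B x x₃ 0‖))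
    (hlocx₃ : ∀ x x₃, ∀ y ∈ ball (0 : W) a,
      ‖fderiv ℂ H y (B x x₃ 3)‖ ≤ Real.exp (-(D.δ₀ * D.distX x₃)) * (K * ‖B x x₃ 3‖))
    (hB₃ : max SH K * (max 1 (2 * (4 : ℝ) / a)) ^ 4 ≤ D.B₃)
    (hDhalf : Display286Printed ({ D with δ₀ := D.δ₀ / 2 } : PointData286 P)) {c₀ c₁ : ℝ} (hL : 0 ≤ D.Ljη)
    (hc₁ : 0 ≤ c₁)
    (hsum0 : ∑ x, Real.exp (-(D.δ₁ * D.dist0 x)) ≤ c₀)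
    (hsum1 : ∀ x, ∑ x₃, Real.exp (-(D.δ₁ * D.len x x₃)) * D.len x x₃ ≤ c₁)
    (c : OrderedFinpartition 4) (hc : c.index 0 = c.index 3) :
    ‖∑ x, ∑ x₃, iteratedFDeriv ℂ c.length f 0 (blockIns (𝕜 := ℂ) H 0 (B x x₃) c)‖ ≤
      (8 * D.B₃ * (D.α₁ / D.α₂)) ^ 4 * D.E₀ * c₀ * c₁ * Real.exp (-(1 / 3 * D.κ * D.djX)) * D.Ljη ^ 5 := by
  have hE₀ : 0 ≤ D.E₀ := by
    by_contra h
    push Not at h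
    have h1 := hS 0 (mem_ball_self hα)
    have h2 : D.E₀ * Real.exp (-(D.κ * D.djX)) < 0 := mul_neg_of_neg_of_pos h (Real.exp_pos _)
    linarith [norm_nonneg (f 0)]
  exact differentBlocks_summed_le ({ D with δ₀ := D.δ₀ / 2 } : PointData286 P) _
    (termEstimate286_sameBlock D hU hα hαB hball hf hS hUW ha hballW hH hSH hK B hB0 hB1 hB2 hB3 hδ hlocx hlocx₃
      hB₃ c hc) hDhalf hE₀ hL hc₁ hsum0 hsum1

/-! ## §5. (4.22) for the ACTUAL expansion (4.3) of the second sum of (4.21): BOTH families derived -/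

/-- **(4.22) for the ACTUAL second sum of (4.21), the different-blocks AND the same-block terms DERIVED.**  *"Summing
over x, x₃ we get finally the following estimate |(the second sum in (4.21))| ≦ (32B₃ (α₁/α₂) c₀(δ₁)c₁(δ₁))⁴
exp(−⅓κd_j(X)) (L^jη)⁵ (4.22)"* — r20's decl of record `KernelBound422Printed` for
`lhs2 := ‖Σ_{x,x₃} D⁴(𝐄∘𝐇)(0)[δB(x), B, B, (∂B)(Γ_{x,x₃})]‖` (the second sum of (4.21) written through (4.2)–(4.3)),
from: (4.4) + (1.18) for `𝐄`; [15] Prop. 9 for `𝐇_j(□₀,·)` (`H` analytic with sup `S_H`, `H(0) = 0`); the two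
first-order localisation bounds of p. 282; the sizes; the p. 286 display AT RATE `δ₀/2`
(`Display286Printed {D with δ₀ := δ₀/2}` — by reference; it implies the printed one, `display286_of_half`, which
serves the different-blocks family through r20's `kernelBound422_actual`, and it serves the same-block family through
`sameBlock_summed_actual`); the lattice sums `c₀(δ₁)`, `c₁(δ₁)`; r20's bookkeeping `E₀ ≤ 1 ≤ c₀c₁`.  Compared with
r20 g11's `kernelBound422_actual`, the [15] Sect. G hypothesis `hsame` is GONE and `hD` is taken at `δ₀/2` (HONEST
SCOPE (1)–(2)). [cite: Balaban1987RG1, (4.21)–(4.22) pp.285–286; p.282] -/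
theorem kernelBound422_actual_of_halfDisplay [Fintype P] (D : PointData286 P)
    {U : Set E} (hU : IsOpen U) (hα : 0 < D.α₂) (hαB : D.α₂ ≤ 8 * D.B₃) (hball : ball (0 : E) D.α₂ ⊆ U)
    {f : E → F} (hf : AnalyticOnNhd ℂ f U)
    (hS : ∀ y ∈ ball (0 : E) D.α₂, ‖f y‖ ≤ D.E₀ * Real.exp (-(D.κ * D.djX)))
    {UW : Set W} (hUW : IsOpen UW) {a SH K : ℝ} (ha : 0 < a) (hballW : ball (0 : W) a ⊆ UW)
    {H : W → E} (hH : AnalyticOnNhd ℂ H UW) (hSH : ∀ y ∈ ball (0 : W) a, ‖H y‖ ≤ SH) (hH0 : H 0 = 0)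
    (hK : 0 ≤ K)
    (B : P → P → Fin 4 → W) (hB0 : ∀ x x₃, ‖B x x₃ 0‖ ≤ D.δB x) (hB1 : ∀ x x₃, ‖B x x₃ 1‖ ≤ D.normB)
    (hB2 : ∀ x x₃, ‖B x x₃ 2‖ ≤ D.normB) (hB3 : ∀ x x₃, ‖B x x₃ 3‖ ≤ D.dBΓ x x₃)
    (hδ : ∀ x, 0 ≤ D.δ₀ * D.distX x)
    (hlocx : ∀ x x₃, ∀ y ∈ ball (0 : W) a,
      ‖fderiv ℂ H y (B x x₃ 0)‖ ≤ Real.exp (-(D.δ₀ * D.distX x)) * (K * ‖B x x₃ 0‖))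
    (hlocx₃ : ∀ x x₃, ∀ y ∈ ball (0 : W) a,
      ‖fderiv ℂ H y (B x x₃ 3)‖ ≤ Real.exp (-(D.δ₀ * D.distX x₃)) * (K * ‖B x x₃ 3‖))
    (hB₃ : max SH K * (max 1 (2 * (4 : ℝ) / a)) ^ 4 ≤ D.B₃)
    (hDhalf : Display286Printed ({ D with δ₀ := D.δ₀ / 2 } : PointData286 P)) {c₀ c₁ : ℝ} (hL : 0 ≤ D.Ljη)
    (hc₁ : 0 ≤ c₁) (hE₁ : D.E₀ ≤ 1) (hcc : 1 ≤ c₀ * c₁)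
    (hsum0 : ∑ x, Real.exp (-(D.δ₁ * D.dist0 x)) ≤ c₀)
    (hsum1 : ∀ x, ∑ x₃, Real.exp (-(D.δ₁ * D.len x x₃)) * D.len x x₃ ≤ c₁) :
    KernelBound422Printed
      ⟨‖∑ x, ∑ x₃, iteratedFDeriv ℂ 4 (f ∘ H) 0 (B x x₃)‖, D.B₃, D.α₁, D.α₂, c₀, c₁, D.κ, D.djX, D.Ljη⟩ := by
  have hE₀ : 0 ≤ D.E₀ := by
    by_contra h
    push Not at h
    have h1 := hS 0 (mem_ball_self hα)
    have h2 : D.E₀ * Real.exp (-(D.κ * D.djX)) < 0 := mul_neg_of_neg_of_pos h (Real.exp_pos _)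
    linarith [norm_nonneg (f 0)]
  -- the sizes are non-negative wherever they are used (vacuously so on an empty carrier)
  have hδB : ∀ x, 0 ≤ D.δB x := fun x => (norm_nonneg _).trans (hB0 x x)
  have hdBΓ : ∀ x x₃, 0 ≤ D.dBΓ x x₃ := fun x x₃ => (norm_nonneg _).trans (hB3 x x₃)
  have hD : Display286Printed D := display286_of_half D hE₀ hδB hdBΓ hδ hDhalf
  exact kernelBound422_actual D hU hα hαB hball hf hS hUW ha hballW hH hSH hH0 hK B hB0 hB1 hB2 hB3 hδ hlocx hlocx₃
    hB₃ hD hL hc₁ hE₁ hcc hsum0 hsum1 fun c hc =>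
      sameBlock_summed_actual D hU hα hαB hball hf hS hUW ha hballW hH hSH hK B hB0 hB1 hB2 hB3 hδ hlocx hlocx₃ hB₃
        hDhalf hL hc₁ hsum0 hsum1 c hc

/-! ## §6. The same with the lattice-sum constants explicit (r20 g11 v1.2 `kernelBound422_actual_l1`) -/

section LatticeSums

open B2Lemma25Proof

variable {ν : ℕ}

/-- **(4.22) for the ACTUAL second sum of (4.21) with `c₀(δ₁) = (1 + 2/δ₁)^ν`, `c₁(δ₁) = (2/δ₁)(1 + 4/δ₁)^ν` EXPLICIT
and BOTH families derived** — r20 g11's `kernelBound422_actual_l1` (points located injectively on `ℤ^ν`, `|x − x₀|`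
and `|x₃ − x|` the ℓ¹ distances, `0 < δ₁ ≤ 2`; lattice sums `latticeSum_c0_le` / `latticeSum_c1_le`) with its [15]
Sect. G hypothesis `hsame` REMOVED and the display taken at rate `δ₀/2` (`Display286Printed {D with δ₀ := δ₀/2}`,
HONEST SCOPE (1)–(2)). [cite: Balaban1987RG1, (4.21)–(4.22) pp.285–286; p.282] -/
theorem kernelBound422_actual_l1_of_halfDisplay [Fintype P] (D : PointData286 P)
    (loc : P → (Fin ν → ℤ)) (hloc : Function.Injective loc)
    (hdist0 : ∀ x, D.dist0 x = l1dist (loc x) (loc D.x₀)) (hlen : ∀ x x₃, D.len x x₃ = l1dist (loc x) (loc x₃))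
    (hδ₁ : 0 < D.δ₁) (hδ₁2 : D.δ₁ ≤ 2)
    {U : Set E} (hU : IsOpen U) (hα : 0 < D.α₂) (hαB : D.α₂ ≤ 8 * D.B₃) (hball : ball (0 : E) D.α₂ ⊆ U)
    {f : E → F} (hf : AnalyticOnNhd ℂ f U)
    (hS : ∀ y ∈ ball (0 : E) D.α₂, ‖f y‖ ≤ D.E₀ * Real.exp (-(D.κ * D.djX)))
    {UW : Set W} (hUW : IsOpen UW) {a SH K : ℝ} (ha : 0 < a) (hballW : ball (0 : W) a ⊆ UW)
    {H : W → E} (hH : AnalyticOnNhd ℂ H UW) (hSH : ∀ y ∈ ball (0 : W) a, ‖H y‖ ≤ SH) (hH0 : H 0 = 0)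
    (hK : 0 ≤ K)
    (B : P → P → Fin 4 → W) (hB0 : ∀ x x₃, ‖B x x₃ 0‖ ≤ D.δB x) (hB1 : ∀ x x₃, ‖B x x₃ 1‖ ≤ D.normB)
    (hB2 : ∀ x x₃, ‖B x x₃ 2‖ ≤ D.normB) (hB3 : ∀ x x₃, ‖B x x₃ 3‖ ≤ D.dBΓ x x₃)
    (hδ : ∀ x, 0 ≤ D.δ₀ * D.distX x)
    (hlocx : ∀ x x₃, ∀ y ∈ ball (0 : W) a,
      ‖fderiv ℂ H y (B x x₃ 0)‖ ≤ Real.exp (-(D.δ₀ * D.distX x)) * (K * ‖B x x₃ 0‖))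
    (hlocx₃ : ∀ x x₃, ∀ y ∈ ball (0 : W) a,
      ‖fderiv ℂ H y (B x x₃ 3)‖ ≤ Real.exp (-(D.δ₀ * D.distX x₃)) * (K * ‖B x x₃ 3‖))
    (hB₃ : max SH K * (max 1 (2 * (4 : ℝ) / a)) ^ 4 ≤ D.B₃)
    (hDhalf : Display286Printed ({ D with δ₀ := D.δ₀ / 2 } : PointData286 P)) (hL : 0 ≤ D.Ljη) (hE₁ : D.E₀ ≤ 1) :
    KernelBound422Printed
      ⟨‖∑ x, ∑ x₃, iteratedFDeriv ℂ 4 (f ∘ H) 0 (B x x₃)‖, D.B₃, D.α₁, D.α₂,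
        (1 + 2 / D.δ₁) ^ ν, 2 / D.δ₁ * (1 + 4 / D.δ₁) ^ ν, D.κ, D.djX, D.Ljη⟩ := by
  have hE₀ : 0 ≤ D.E₀ := by
    by_contra h
    push Not at h
    have h1 := hS 0 (mem_ball_self hα)
    have h2 : D.E₀ * Real.exp (-(D.κ * D.djX)) < 0 := mul_neg_of_neg_of_pos h (Real.exp_pos _)
    linarith [norm_nonneg (f 0)]
  have hδB : ∀ x, 0 ≤ D.δB x := fun x => (norm_nonneg _).trans (hB0 x x)
  have hdBΓ : ∀ x x₃, 0 ≤ D.dBΓ x x₃ := fun x x₃ => (norm_nonneg _).trans (hB3 x x₃)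
  have hD : Display286Printed D := display286_of_half D hE₀ hδB hdBΓ hδ hDhalf
  have hc₁1 : 1 ≤ 2 / D.δ₁ * (1 + 4 / D.δ₁) ^ ν :=
    one_le_mul_of_one_le_of_one_le ((one_le_div hδ₁).2 hδ₁2)
      (one_le_pow₀ (by linarith [div_nonneg (by norm_num : (0:ℝ) ≤ 4) hδ₁.le] : (1 : ℝ) ≤ 1 + 4 / D.δ₁))
  have hc₁ : 0 ≤ 2 / D.δ₁ * (1 + 4 / D.δ₁) ^ ν := zero_le_one.trans hc₁1
  have hsum0 : ∑ x, Real.exp (-(D.δ₁ * D.dist0 x)) ≤ (1 + 2 / D.δ₁) ^ ν := by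
    simp_rw [hdist0]
    exact latticeSum_c0_le loc hloc D.x₀ hδ₁
  have hsum1 : ∀ x, ∑ x₃, Real.exp (-(D.δ₁ * D.len x x₃)) * D.len x x₃ ≤ 2 / D.δ₁ * (1 + 4 / D.δ₁) ^ ν := by
    intro x
    simp_rw [hlen]
    exact latticeSum_c1_le loc hloc x hδ₁
  exact kernelBound422_actual_l1 D loc hloc hdist0 hlen hδ₁ hδ₁2 hU hα hαB hball hf hS hUW ha hballW hH hSH hH0 hK B
    hB0 hB1 hB2 hB3 hδ hlocx hlocx₃ hB₃ hD hL hE₁ fun c hc =>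
      sameBlock_summed_actual D hU hα hαB hball hf hS hUW ha hballW hH hSH hK B hB0 hB1 hB2 hB3 hδ hlocx hlocx₃ hB₃
        hDhalf hL hc₁ hsum0 hsum1 c hc

end LatticeSums

/-! ## §7 (v1.1). The bookkeeping `E₀ ≤ 1` absorbed into the located constant `c₀′ = max{1, E₀}·c₀` -/

/-- **The constant of (4.22) with `E₀` absorbed.**  Print's constant `(32B₃α₁α₂⁻¹c₀(δ₁)c₁(δ₁))⁴` carries no `E₀` (the
(1.18) constant is silently absorbed); r20 g1's `kernelBound422_of_terms` reaches it under the bookkeeping `E₀ ≤ 1 ≤ c₀c₁`.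
Without `E₀ ≤ 1`: the same per-term bounds give `KernelBound422Printed` with the located constant `c₀′ = max{1, E₀}·c₀` in
place of `c₀` (apply r20's lemma with `E₀′ = E₀/max{1, E₀} ≤ 1`, `E₀′c₀′ = E₀c₀`, `c₀′c₁ = max{1,E₀}·c₀c₁ ≥ 1`).
[cite: Balaban1987RG1, (4.22) p.286] -/
theorem kernelBound422_of_terms_maxE₀ {T : Type*} (fam : Finset T) (hT : fam.card ≤ 4 ^ 4) (s : T → ℝ)
    {lhs2 B₃ α₁ α₂ E₀ c₀ c₁ κ djX Ljη : ℝ} (hE₀ : 0 ≤ E₀) (hc : 1 ≤ c₀ * c₁) (hL : 0 ≤ Ljη)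
    (hlhs : lhs2 ≤ ∑ Q ∈ fam, s Q)
    (hs : ∀ Q ∈ fam, s Q ≤ (8 * B₃ * (α₁ / α₂)) ^ 4 * E₀ * c₀ * c₁ * Real.exp (-(1 / 3 * κ * djX)) * Ljη ^ 5) :
    KernelBound422Printed ⟨lhs2, B₃, α₁, α₂, max 1 E₀ * c₀, c₁, κ, djX, Ljη⟩ := by
  have hm : 1 ≤ max 1 E₀ := le_max_left _ _
  have hm0 : 0 < max 1 E₀ := zero_lt_one.trans_le hm
  have hE' : E₀ / max 1 E₀ ≤ 1 := div_le_one_of_le₀ (le_max_right _ _) hm0.le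
  have hE'0 : 0 ≤ E₀ / max 1 E₀ := div_nonneg hE₀ hm0.le
  have hc' : 1 ≤ max 1 E₀ * c₀ * c₁ := by
    calc (1 : ℝ) = 1 * 1 := (mul_one _).symm
      _ ≤ max 1 E₀ * (c₀ * c₁) := mul_le_mul hm hc zero_le_one hm0.le
      _ = max 1 E₀ * c₀ * c₁ := (mul_assoc _ _ _).symm
  refine kernelBound422_of_terms ⟨lhs2, B₃, α₁, α₂, max 1 E₀ * c₀, c₁, κ, djX, Ljη⟩ fam hT s hE'0 hE' hc' hL hlhs ?_
  intro Q hQ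
  have h : (8 * B₃ * (α₁ / α₂)) ^ 4 * (E₀ / max 1 E₀) * (max 1 E₀ * c₀) * c₁ * Real.exp (-(1 / 3 * κ * djX)) * Ljη ^ 5 =
      (8 * B₃ * (α₁ / α₂)) ^ 4 * E₀ * c₀ * c₁ * Real.exp (-(1 / 3 * κ * djX)) * Ljη ^ 5 := by
    field_simp
  show s Q ≤ (8 * B₃ * (α₁ / α₂)) ^ 4 * (E₀ / max 1 E₀) * (max 1 E₀ * c₀) * c₁ * Real.exp (-(1 / 3 * κ * djX)) * Ljη ^ 5
  rw [h]
  exact hs Q hQ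

/-- **(4.22) for the ACTUAL second sum of (4.21), both families derived, `E₀` absorbed** — `kernelBound422_actual_of_halfDisplay`
without the bookkeeping hypothesis `E₀ ≤ 1`, concluding r20's decl of record with the located lattice constant
`c₀′ = max{1, E₀}·c₀` (`kernelBound422_of_terms_maxE₀`); all other inputs as there ((4.4)+(1.18), [15] Prop. 9, the two
first-order localisation bounds, the sizes, `Display286Printed {D with δ₀ := δ₀/2}`, the lattice sums, `1 ≤ c₀c₁`).
[cite: Balaban1987RG1, (4.21)–(4.22) pp.285–286; p.282] -/
theorem kernelBound422_actual_of_halfDisplay_maxE₀ [Fintype P] (D : PointData286 P)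
    {U : Set E} (hU : IsOpen U) (hα : 0 < D.α₂) (hαB : D.α₂ ≤ 8 * D.B₃) (hball : ball (0 : E) D.α₂ ⊆ U)
    {f : E → F} (hf : AnalyticOnNhd ℂ f U)
    (hS : ∀ y ∈ ball (0 : E) D.α₂, ‖f y‖ ≤ D.E₀ * Real.exp (-(D.κ * D.djX)))
    {UW : Set W} (hUW : IsOpen UW) {a SH K : ℝ} (ha : 0 < a) (hballW : ball (0 : W) a ⊆ UW)
    {H : W → E} (hH : AnalyticOnNhd ℂ H UW) (hSH : ∀ y ∈ ball (0 : W) a, ‖H y‖ ≤ SH) (hH0 : H 0 = 0)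
    (hK : 0 ≤ K)
    (B : P → P → Fin 4 → W) (hB0 : ∀ x x₃, ‖B x x₃ 0‖ ≤ D.δB x) (hB1 : ∀ x x₃, ‖B x x₃ 1‖ ≤ D.normB)
    (hB2 : ∀ x x₃, ‖B x x₃ 2‖ ≤ D.normB) (hB3 : ∀ x x₃, ‖B x x₃ 3‖ ≤ D.dBΓ x x₃)
    (hδ : ∀ x, 0 ≤ D.δ₀ * D.distX x)
    (hlocx : ∀ x x₃, ∀ y ∈ ball (0 : W) a,
      ‖fderiv ℂ H y (B x x₃ 0)‖ ≤ Real.exp (-(D.δ₀ * D.distX x)) * (K * ‖B x x₃ 0‖))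
    (hlocx₃ : ∀ x x₃, ∀ y ∈ ball (0 : W) a,
      ‖fderiv ℂ H y (B x x₃ 3)‖ ≤ Real.exp (-(D.δ₀ * D.distX x₃)) * (K * ‖B x x₃ 3‖))
    (hB₃ : max SH K * (max 1 (2 * (4 : ℝ) / a)) ^ 4 ≤ D.B₃)
    (hDhalf : Display286Printed ({ D with δ₀ := D.δ₀ / 2 } : PointData286 P)) {c₀ c₁ : ℝ} (hL : 0 ≤ D.Ljη)
    (hc₁ : 0 ≤ c₁) (hcc : 1 ≤ c₀ * c₁)
    (hsum0 : ∑ x, Real.exp (-(D.δ₁ * D.dist0 x)) ≤ c₀)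
    (hsum1 : ∀ x, ∑ x₃, Real.exp (-(D.δ₁ * D.len x x₃)) * D.len x x₃ ≤ c₁) :
    KernelBound422Printed
      ⟨‖∑ x, ∑ x₃, iteratedFDeriv ℂ 4 (f ∘ H) 0 (B x x₃)‖, D.B₃, D.α₁, D.α₂, max 1 D.E₀ * c₀, c₁, D.κ, D.djX,
        D.Ljη⟩ := by
  have hE₀ : 0 ≤ D.E₀ := by
    by_contra h
    push Not at h
    have h1 := hS 0 (mem_ball_self hα)
    have h2 : D.E₀ * Real.exp (-(D.κ * D.djX)) < 0 := mul_neg_of_neg_of_pos h (Real.exp_pos _)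
    linarith [norm_nonneg (f 0)]
  have hδB : ∀ x, 0 ≤ D.δB x := fun x => (norm_nonneg _).trans (hB0 x x)
  have hdBΓ : ∀ x x₃, 0 ≤ D.dBΓ x x₃ := fun x x₃ => (norm_nonneg _).trans (hB3 x x₃)
  have hD : Display286Printed D := display286_of_half D hE₀ hδB hdBΓ hδ hDhalf
  have hcount : (Finset.univ : Finset (OrderedFinpartition 4)).card ≤ 4 ^ 4 := by
    rw [Finset.card_univ]
    exact card_orderedFinpartition_le_pow 4
  refine kernelBound422_of_terms_maxE₀ Finset.univ hcount
    (fun c => ‖∑ x, ∑ x₃, iteratedFDeriv ℂ c.length f 0 (blockIns (𝕜 := ℂ) H 0 (B x x₃) c)‖) hE₀ hcc hL ?_ ?_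
  · -- (4.3) + triangle inequality over the partitions
    rw [secondSum_expansion hU hα hball hf hUW ha hballW hH hH0 B]
    exact norm_sum_le _ _
  · intro c _
    by_cases hc : c.index 0 = c.index 3
    · exact sameBlock_summed_actual D hU hα hαB hball hf hS hUW ha hballW hH hSH hK B hB0 hB1 hB2 hB3 hδ hlocx hlocx₃
        hB₃ hDhalf hL hc₁ hsum0 hsum1 c hc
    · exact differentBlocks_summed_actual D hU hα hαB hball hf hS hUW ha hballW hH hSH hK B hB0 hB1 hB2 hB3 hδ
        hlocx hlocx₃ hB₃ hD hL hc₁ hsum0 hsum1 c hc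

end Literature.MathematicalPhysics.QuantumFieldTheory.Balaban1983to89.B12Term286SameBlock

end
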